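import Summits.CriticalPhenomena.Ising3D.TaylorRegionDeltaOdd
import Mathlib.Tactic.Linarith
import HarnessLib

/-!
# `TaylorTable` glue and the WIDE-BOX capstone of the δ-expanded region layer (item (L4b);
HOME/pub-ising3x-recog-1/gen12/REGION-ON-MARGIN-FUNCTIONAL.md §5–§6)
(cell `pub-ising3x`, seat recog-1 gen 12; gate (g2))

HONEST FRAMING: lottery ticket; floor = tightest certified 3D Ising CFT bounds; no exact-solution
claim without a proof. Island framing: certified exclusion region at stated derivative order and
assumptions; not a determination of the 3D Ising critical exponents beyond that.

`EvenRegionParamsΔ` / `OddConeParamsΔ` (the producer's free parameters), `TaylorTable.evenDataΔ` / `TaylorTable.oddDataΔ` (the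
table's wide-box region data), `TaylorTable.evenRegion_of_splitΔ` / `TaylorTable.oddCone_of_splitΔ`, and the all-Boolean
capstone **`TaylorTable.boxExcluded_of_taylorTable_dec_of_splitΔ`**: `T.check`, `T.checkEncl`, the even split Booleans
(sizes / landed tails / per-row containment of δ-row triples / per-piece triple tests) and the odd ones (atoms / sizes / tail /
containment / affine piece tests) ⇒ `BoxExcluded T.box` — for a box whose width is limited by the termwise margins of the
functional, not by interval decorrelation. Elementary glue. [folklore]
-/

namespace Summit.CriticalPhenomena.Ising3D

open Finset Set
open Literature.Analysis.ValidatedNumerics Literature.Analysis.ValidatedNumerics.PolyMP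
open Literature.Analysis.ValidatedNumerics.NumericsMP (MI)
open Literature.MathematicalPhysics.QuantumFieldTheory.ConformalBootstrap3D

/-- Producer parameters, even sector, wide box. [folklore] -/
structure EvenRegionParamsΔ where
  S : ℕ
  E1 : ℚ
  J1 : ℕ
  ccQ : ℚ
  ccT : ℚ
  N : ℕ
  R : ℕ
  prmX : HSParams
  prmY : HSParams
  prmD : HSParams
  dPj : ℕ

/-- Producer parameters, odd cone, wide box. [folklore] -/
structure OddConeParamsΔ where
  S : ℕ
  E1 : ℚ
  J1 : ℕ
  ccQ : ℚ
  ccT : ℚ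
  N : ℕ
  R : ℕ
  dPj : ℕ
  k1lo : RootAtom
  k1hi : RootAtom
  k2lo : RootAtom
  k2hi : RootAtom
  k3lo : RootAtom
  k3hi : RootAtom
  prmM1 : HSParams
  prmM2 : HSParams
  prmR1 : HSParams
  prmR2 : HSParams

namespace TaylorTable

variable (T : TaylorTable)

/-- The table's wide-box even-region data. [folklore] -/
def evenDataΔ (π : EvenRegionParamsΔ) : EvenRegionDataΔ where
  S := π.S
  l := T.L
  cQ := T.c
  σlo := T.σlo
  σhi := T.σhi
  εlo := T.εlo
  εhi := T.εhi
  E0 := T.E₀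
  E1 := π.E1
  J1 := π.J1
  ccQ := π.ccQ
  ccT := π.ccT
  N := π.N
  R := π.R
  prmX := π.prmX
  prmY := π.prmY
  prmD := π.prmD
  dPj := π.dPj

/-- The table's wide-box odd-cone data. [folklore] -/
def oddDataΔ (π : OddConeParamsΔ) : OddConeRegionDataΔ where
  S := π.S
  σlo := T.σlo
  σhi := T.σhi
  εlo := T.εlo
  εhi := T.εhi
  l := T.L
  cQ := T.c
  lψ := T.Lψ
  ψQ := T.ψ
  κ₀Q := T.κ₀
  k1lo := π.k1lo
  k1hi := π.k1hi
  k2lo := π.k2lo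
  k2hi := π.k2hi
  k3lo := π.k3lo
  k3hi := π.k3hi
  E0 := T.E_T
  E1 := π.E1
  J1 := π.J1
  ccQ := π.ccQ
  ccT := π.ccT
  N := π.N
  R := π.R
  prmM1 := π.prmM1
  prmM2 := π.prmM2
  prmR1 := π.prmR1
  prmR2 := π.prmR2
  dPj := π.dPj

/-- **The table's even region over its whole box from the δ-split Booleans.** [folklore] -/
theorem evenRegion_of_splitΔ (π : EvenRegionParamsΔ) (LT : IPoly2 × IPoly2 × IPoly2)
    (L : List (ITriple × ITriple × ITriple)) {K : ℕ} (hK : 0 < K) (hl : (T.evenDataΔ π).l.Nodup)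
    (hs : (T.evenDataΔ π).sizesOK = true) (hLT : (T.evenDataΔ π).toH.tailLitOK LT = true)
    (hX : (T.evenDataΔ π).toH.tailXOKL LT = true) (hY : (T.evenDataΔ π).toH.tailYOKL LT = true)
    (hD : ∀ k : ℕ, k < (T.evenDataΔ π).prmD.nθ → (T.evenDataΔ π).toH.tailDCellOKL LT k = true)
    (hr : ∀ j : ℕ, j < (T.evenDataΔ π).J1 + 1 → (T.evenDataΔ π).rowLitOK L j = true)
    (hp : ∀ j k : ℕ, j < (T.evenDataΔ π).J1 + 1 → k < K → (T.evenDataΔ π).pieceOK L K j k = true) :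
    TaylorEvenRegion T.α T.box ((T.E₀ : ℚ) : ℝ) :=
  taylorEvenRegion_of_splitΔ (T.evenDataΔ π) LT L hK hl hs hLT hX hY hD hr hp

/-- **The table's odd cone over its whole box from the δ-split Booleans.** [folklore] -/
theorem oddCone_of_splitΔ (π : OddConeParamsΔ) (L : List OddLit) {K : ℕ} (hK : 0 < K)
    (hl : (T.oddDataΔ π).l.Nodup) (hlψ : (T.oddDataΔ π).lψ.Nodup) (ha : (T.oddDataΔ π).toCertH.atomsOK = true)
    (hs : (T.oddDataΔ π).sizesOK = true) (ht : (T.oddDataΔ π).toCertH.data.tail.check = true)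
    (hr : ∀ j : ℕ, j < (T.oddDataΔ π).J1 + 1 → (T.oddDataΔ π).rowLitOK L j = true)
    (hp : ∀ j k : ℕ, j < (T.oddDataΔ π).J1 + 1 → k < K → (T.oddDataΔ π).pieceOK L K j k = true) : T.OddCone :=
  Summit.CriticalPhenomena.Ising3D.oddCone_of_splitΔ (T.oddDataΔ π) L hK hl hlψ ha hs ht hr hp

/-- **WIDE-BOX CAPSTONE**: table check, enclosure check, even δ-split Booleans, odd δ-split Booleans ⇒ the box is excluded.
[folklore] -/
theorem boxExcluded_of_taylorTable_dec_of_splitΔ (h : T.check = true) (he : T.checkEncl = true)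
    (πE : EvenRegionParamsΔ) (LT : IPoly2 × IPoly2 × IPoly2) (LE : List (ITriple × ITriple × ITriple)) {KE : ℕ}
    (hKE : 0 < KE) (hlE : (T.evenDataΔ πE).l.Nodup) (hsE : (T.evenDataΔ πE).sizesOK = true)
    (hLT : (T.evenDataΔ πE).toH.tailLitOK LT = true) (hX : (T.evenDataΔ πE).toH.tailXOKL LT = true)
    (hY : (T.evenDataΔ πE).toH.tailYOKL LT = true)
    (hD : ∀ k : ℕ, k < (T.evenDataΔ πE).prmD.nθ → (T.evenDataΔ πE).toH.tailDCellOKL LT k = true)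
    (hrE : ∀ j : ℕ, j < (T.evenDataΔ πE).J1 + 1 → (T.evenDataΔ πE).rowLitOK LE j = true)
    (hpE : ∀ j k : ℕ, j < (T.evenDataΔ πE).J1 + 1 → k < KE → (T.evenDataΔ πE).pieceOK LE KE j k = true)
    (πO : OddConeParamsΔ) (LO : List OddLit) {KO : ℕ} (hKO : 0 < KO) (hlO : (T.oddDataΔ πO).l.Nodup)
    (hlψ : (T.oddDataΔ πO).lψ.Nodup) (haO : (T.oddDataΔ πO).toCertH.atomsOK = true)
    (hsO : (T.oddDataΔ πO).sizesOK = true) (htO : (T.oddDataΔ πO).toCertH.data.tail.check = true)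
    (hrO : ∀ j : ℕ, j < (T.oddDataΔ πO).J1 + 1 → (T.oddDataΔ πO).rowLitOK LO j = true)
    (hpO : ∀ j k : ℕ, j < (T.oddDataΔ πO).J1 + 1 → k < KO → (T.oddDataΔ πO).pieceOK LO KO j k = true) :
    BoxExcluded T.box :=
  T.boxExcluded_of_taylorTable_dec h he (T.evenRegion_of_splitΔ πE LT LE hKE hlE hsE hLT hX hY hD hrE hpE)
    (T.oddCone_of_splitΔ πO LO hKO hlO hlψ haO hsO htO hrO hpO)

end TaylorTable

end Summit.CriticalPhenomena.Ising3D
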